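import Mathlib
import Summits.QuantumAdvantage.QuantumAdvantage.Theorems.MobiusLadderDigitPolyUniformityLowAffine

/-!
# Crux `DigitPolyUniformity` (stmt-QuantumAdvantage-1392), line `Sketch` (LAR composition):
# short-interval Walsh uniformity ⇔ uniformity of the low-affine class

Fix a cut `h(n) ≤ n` and split `N = 2^{h} y + x` (`x` = the low `h` binary digits of `N < 2ⁿ`,
`y` = the high `n − h` ones). `Theorems/MobiusLadderDigitPolyUniformityLowAffine.lean` proved `→`:
averaged short-interval Walsh uniformity of `λ` at scale `2^{h(n)}`,

  `∀ ε > 0, ∀ᶠ n, ∀ σ : y ↦ S_y ⊆ {0..h−1}, Σ_{y < 2^{n−h}} |Σ_{x < 2^h} λ(2^h y + x) w_{S_y}(x)| ≤ ε 2ⁿ`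
  (`w_S(x) = Π_{i ∈ S} (−1)^{bit_i x}`),

implies the crux inequality `|Σ_{N<2ⁿ} λ(N) (−1)^{P(bits N)}| ≤ ε 2ⁿ` for every `P ∈ 𝔽₂[x_0..x_{n−1}]`
that is AFFINE IN THE LOW DIGITS with coefficients arbitrary functions of the high digits,
`P(bits N) = Σ_{i<h} bit_i(N) ℓ_i(y) + g(y)`.

This file (`shortWalsh_iff_lowAffine`) upgrades it to an EQUIVALENCE. `←`: given a selection `σ`,
put `I(y) = Σ_{x<2^h} λ(2^h y + x) w_{σ_y}(x)`, `ℓ_i(y) = [i ∈ σ_y]`, `g(y) = [I(y) < 0]`, and realise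
the affine form `N ↦ Σ_{i<h} bit_i(N) ℓ_i(⌊N/2^h⌋) + g(⌊N/2^h⌋)` on `N < 2ⁿ` by an honest polynomial
(interpolation at the digit vectors, `exists_eval_digits_eq`: every function of `N < 2ⁿ` is
`Σ_{M<2ⁿ} f(M)·1_{bits M}` evaluated at `bits N`, with Mathlib's point indicators
`MvPolynomial.indicator`; the digit vectors of distinct `N, M < 2ⁿ` differ, `eq_of_digits_eq`).
On the `y`-th interval `χ_P(2^h y + x) = (−1)^{g(y)} w_{σ_y}(x)` (`sign_bilinear_eq_prod_filter`,
from the `→` file), so `Σ_N λ χ_P = Σ_y (−1)^{g(y)} I(y) = Σ_y |I(y)|`, and the class bound gives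
`Σ_y |I(y)| ≤ |Σ_N λ χ_P| ≤ ε 2ⁿ`. Pure finite sums; no named facts.
-/

namespace Summit.QuantumAdvantage.DigitPolyUniformity.SketchLAR

open Filter Finset
open Summit.QuantumAdvantage.DigitPolyUniformity.Sketch (sum_range_mul_split)

namespace ShortWalshIffLowAffine

/-- Digit vectors separate the integers below `2ⁿ`: if `N, M < 2ⁿ` have the same `0/1` digit
vector in `𝔽₂ⁿ`, then `N = M` (bits `≥ n` vanish, `Nat.testBit_lt_two_pow`). [folklore] -/
theorem eq_of_digits_eq {n N M : ℕ} (hN : N < 2 ^ n) (hM : M < 2 ^ n)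
    (hNM : (fun i : Fin n => if Nat.testBit N i then (1 : ZMod 2) else 0) =
      fun i : Fin n => if Nat.testBit M i then (1 : ZMod 2) else 0) : N = M := by
  have key : ∀ a b : Bool,
      ((if a then (1 : ZMod 2) else 0) = if b then (1 : ZMod 2) else 0) → a = b := by decide
  refine Nat.eq_of_testBit_eq fun i => ?_
  by_cases hi : i < n
  · exact key _ _ (congr_fun hNM ⟨i, hi⟩)
  · have h2 : 2 ^ n ≤ 2 ^ i := Nat.pow_le_pow_right Nat.two_pos (Nat.le_of_not_lt hi)
    rw [Nat.testBit_lt_two_pow (hN.trans_le h2), Nat.testBit_lt_two_pow (hM.trans_le h2)]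

/-- **Interpolation at the digit vectors.** Every `𝔽₂`-valued function of `N < 2ⁿ` is the evaluation
at the digit vector of `N` of some polynomial `Q ∈ 𝔽₂[X_0, …, X_{n−1}]`, namely
`Q = Σ_{M < 2ⁿ} f(M) · 1_{bits M}` with the point indicators `MvPolynomial.indicator`. [folklore] -/
theorem exists_eval_digits_eq (n : ℕ) (f : ℕ → ZMod 2) :
    ∃ Q : MvPolynomial (Fin n) (ZMod 2), ∀ N : ℕ, N < 2 ^ n →
      MvPolynomial.eval (fun i : Fin n => if Nat.testBit N i then (1 : ZMod 2) else 0) Q = f N := by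
  refine ⟨∑ M ∈ Finset.range (2 ^ n),
      f M • MvPolynomial.indicator (fun i : Fin n => if Nat.testBit M i then (1 : ZMod 2) else 0),
    fun N hN => ?_⟩
  rw [map_sum, Finset.sum_eq_single_of_mem N (Finset.mem_range.mpr hN)]
  · rw [MvPolynomial.smul_eval, MvPolynomial.eval_indicator_apply_eq_one, mul_one]
  · intro M hM hMN
    rw [MvPolynomial.smul_eval, MvPolynomial.eval_indicator_apply_eq_zero _ _
        (fun hEq => hMN (eq_of_digits_eq (Finset.mem_range.mp hM) hN hEq.symm)), mul_zero]

/-- The sign bookkeeping of the `←` direction: with `g = [S < 0] ∈ 𝔽₂`, the phase `(−1)^{g}` times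
`S` is `|S|`. [folklore] -/
theorem sign_neg_indicator_mul_eq_abs (S : ℝ) :
    (if (if S < 0 then (1 : ZMod 2) else 0) = 1 then (-1 : ℝ) else 1) * S = |S| := by
  by_cases hS : S < 0
  · rw [if_pos hS, if_pos rfl, abs_of_neg hS, neg_one_mul]
  · rw [if_neg hS, if_neg zero_ne_one, abs_of_nonneg (not_lt.mp hS), one_mul]

end ShortWalshIffLowAffine

open LowAffineOfShortWalsh ShortWalshIffLowAffine in
/-- **Short-interval Walsh uniformity ⇔ uniformity of the low-affine class.** For a cut `h(n) ≤ n`,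
the averaged short-interval Walsh uniformity hypothesis of
`digitPolyUniformity_lowAffine_of_shortWalsh` (for every `ε > 0`, eventually in `n`, for every
selection `σ : y ↦ S_y ⊆ {0..h−1}`, `Σ_{y < 2^{n−h}} |Σ_{x < 2^h} λ(2^h y + x) w_{S_y}(x)| ≤ ε 2ⁿ`) is
EQUIVALENT to the crux inequality for the whole low-affine class at that cut (every `P` with
`P(bits N) = Σ_{i<h} bit_i(N) ℓ_i(⌊N/2^h⌋) + g(⌊N/2^h⌋)` on `N < 2ⁿ`, no degree restriction).
`→` is `digitPolyUniformity_lowAffine_of_shortWalsh`; `←`: given `σ`, take `ℓ_i(y) = [i ∈ σ_y]`,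
`g(y) = [Σ_x λ(2^h y + x) w_{σ_y}(x) < 0]`, realise `(ℓ, g)` by an honest polynomial (interpolation at
the digit vectors, `exists_eval_digits_eq`), and observe
`Σ_N λ χ_P = Σ_y (−1)^{g(y)} Σ_x λ w_{σ_y} = Σ_y |Σ_x λ w_{σ_y}| ≤ |Σ_N λ χ_P| ≤ ε 2ⁿ`. [folklore] -/
theorem shortWalsh_iff_lowAffine (h : ℕ → ℕ) (hh : ∀ n, h n ≤ n) :
    (∀ ε : ℝ, 0 < ε → ∀ᶠ n : ℕ in atTop, ∀ σ : ℕ → Finset (Fin (h n)),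
      ∑ y ∈ Finset.range (2 ^ (n - h n)),
        |∑ x ∈ Finset.range (2 ^ h n), ((ArithmeticFunction.liouville (2 ^ h n * y + x) : ℤ) : ℝ) *
            ∏ i ∈ σ y, (if Nat.testBit x i then (-1 : ℝ) else 1)| ≤ ε * (2 : ℝ) ^ n) ↔
    (∀ ε : ℝ, 0 < ε → ∀ᶠ n : ℕ in atTop, ∀ P : MvPolynomial (Fin n) (ZMod 2),
      (∃ ℓ : Fin (h n) → ℕ → ZMod 2, ∃ g : ℕ → ZMod 2, ∀ N : ℕ, N < 2 ^ n →
          MvPolynomial.eval (fun i : Fin n => if Nat.testBit N i then (1 : ZMod 2) else 0) P =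
            ∑ i : Fin (h n), (if Nat.testBit N i then (1 : ZMod 2) else 0) * ℓ i (N / 2 ^ h n) +
              g (N / 2 ^ h n)) →
        |∑ N ∈ Finset.range (2 ^ n), ((ArithmeticFunction.liouville N : ℤ) : ℝ) *
            (if MvPolynomial.eval (fun i : Fin n => if Nat.testBit N i then (1 : ZMod 2) else 0) P = 1
              then (-1 : ℝ) else 1)| ≤ ε * (2 : ℝ) ^ n) := by
  refine ⟨digitPolyUniformity_lowAffine_of_shortWalsh h hh, fun hLA ε hε => ?_⟩
  filter_upwards [hLA ε hε] with n hn
  intro σ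
  -- the low-affine data: `ℓ_i(y) = [i ∈ σ_y]`, `g(y) = [I(y) < 0]`
  obtain ⟨ℓ, hℓ⟩ : ∃ ℓ : Fin (h n) → ℕ → ZMod 2, ∀ i y, ℓ i y = if i ∈ σ y then 1 else 0 :=
    ⟨_, fun _ _ => rfl⟩
  obtain ⟨g, hg⟩ : ∃ g : ℕ → ZMod 2, ∀ y, g y =
      if ∑ x ∈ Finset.range (2 ^ h n), ((ArithmeticFunction.liouville (2 ^ h n * y + x) : ℤ) : ℝ) *
          ∏ i ∈ σ y, (if Nat.testBit x i then (-1 : ℝ) else 1) < 0 then 1 else 0 :=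
    ⟨_, fun _ => rfl⟩
  have hfilter : ∀ y, (Finset.univ : Finset (Fin (h n))).filter (fun i => ℓ i y = 1) = σ y := by
    intro y
    ext i
    simp only [Finset.mem_filter, Finset.mem_univ, true_and, hℓ]
    by_cases hi : i ∈ σ y <;> simp [hi]
  -- an honest polynomial realising the affine form `Σ_{i<h} bit_i(N) ℓ_i(y) + g(y)` on `N < 2ⁿ`
  obtain ⟨P, hP⟩ := exists_eval_digits_eq n (fun N =>
    ∑ i : Fin (h n), (if Nat.testBit N i then (1 : ZMod 2) else 0) * ℓ i (N / 2 ^ h n) +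
      g (N / 2 ^ h n))
  have key := hn P ⟨ℓ, g, hP⟩
  -- regroup `N < 2ⁿ = 2^h · 2^{n−h}` as `N = 2^h y + x`
  have hsplit : (2 : ℕ) ^ n = 2 ^ h n * 2 ^ (n - h n) := by
    rw [← pow_add, Nat.add_sub_cancel' (hh n)]
  rw [hsplit, sum_range_mul_split] at key
  refine le_trans (le_of_eq ?_) ((le_abs_self _).trans key)
  refine Finset.sum_congr rfl fun y hy => ?_
  have hy : y < 2 ^ (n - h n) := Finset.mem_range.mp hy
  -- on the `y`-th interval the phase is `(−1)^{g y} · w_{σ_y}(x)`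
  have hpt : ∀ x ∈ Finset.range (2 ^ h n),
      ((ArithmeticFunction.liouville (2 ^ h n * y + x) : ℤ) : ℝ) *
          (if MvPolynomial.eval
              (fun i : Fin n => if Nat.testBit (2 ^ h n * y + x) i then (1 : ZMod 2) else 0) P = 1
            then (-1 : ℝ) else 1) =
        (if g y = 1 then (-1 : ℝ) else 1) *
          (((ArithmeticFunction.liouville (2 ^ h n * y + x) : ℤ) : ℝ) *
            ∏ i ∈ σ y, (if Nat.testBit x i then (-1 : ℝ) else 1)) := by
    intro x hx
    have hx : x < 2 ^ h n := Finset.mem_range.mp hx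
    rw [hP _ (two_pow_mul_add_lt n (h n) y (hh n) hx hy), two_pow_mul_add_div (h n) y hx,
      sign_bilinear_eq_prod_filter, hfilter y, mul_left_comm]
    congr 2
    exact Finset.prod_congr rfl fun i _ => by
      rw [testBit_two_pow_mul_add_of_lt (h n) y hx i.isLt]
  rw [Finset.sum_congr rfl hpt, ← Finset.mul_sum, hg y, sign_neg_indicator_mul_eq_abs]

end Summit.QuantumAdvantage.DigitPolyUniformity.SketchLAR
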